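import Summits.QuantumFields.YangMills.Theorems.UnitScaleTiltFluctuationComparisonRegPrPrintChi
import Summits.QuantumFields.YangMills.Theorems.UnitScaleTiltFluctuationComparisonRegPrPrintChiDescentAdapter
import HarnessLib

/-!
# `UnitScaleTiltFluctuationComparisonRegPrPrintChiDescentFeed` — STUB 4′ of crux `FluctuationComparisonRegPrL` (stmt-QuantumFields-19935), (R1)/descent line,
# part 7: THE LEVEL-`(n+1)` SANDWICH FROM THE SOCKETS — the χ-restricted representation `TwoSidedRepOn` of both runs READ ONE LEVEL BELOW the comparison height,
# a two-run Cauchy bound for the interaction data there and the minimiser-stability row there give the hypothesis `hcmp` of the descent sandwich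
# (`PrintChiDescent.fourPrime_pair_of_descent`, p529535) on every measurable good set inside the restricted, doubly-positive data

Cell `ym3-torus`, width-lever lane `ym-ust-19935-r1`.  Count-neutral helper (`--supports stmt-QuantumFields-19935`).  Pure algebra over the schemas; no estimate of
[Balaban1985UV3]/[King1986] is asserted.  With this file the descent shape (II) of the (R1) line reads: 4′-body ⇐ {`TwoSidedRepOn S` (all heights; for `S ⊇`
print's χ it is the landed (A) `repAtHeights_dataOfV3` weakened), a Cauchy bound and a minimiser-stability bound ONE LEVEL BELOW each comparison height on a good
set `G_K`, the conditional bad mass of `G_Kᶜ`, `MinimiserStabilityRegPrAt` at the comparison heights, the `K = 0` clause} — `PrintChi.fourPrimeBody_of_descent_family`.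

* `exp_sandwich_of_abs_log` — `|log y − log x − κ| ≤ r`, `x, y > 0` ⇒ `e^{κ−r}x ≤ y ≤ e^{κ+r}x`.
* `sandwich_succ_of_repOn` — at height `n+1` (`n+1 ≤ K`): `TwoSidedRepOn S` for run `K`'s data and for run `K+1`'s data, a.e. on a measurable `G` inside
  `{PlaqSmall θ(n+1)} ∩ S_K ∩ S_{K+1} ∩ {both histGood·(n+1) densities > 0}` the bounds `|Pint_{K+1} − Pint_K − c| ≤ r′` and `|bg^{(n+1)}_{K+1} − bg^{(n+1)}_K − κ₂| ≤ r₂`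
  ⇒ the two-run sandwich of the `histGood · (n+1)`-restricted densities a.e. on `G` with `κ = c − E_{K+1} + E_K − κ₂`, `r = Rm_K + Rm_{K+1} + r′ + r₂`.
* `sandwich_of_repOn` — the same for the `histGood · n`-restricted densities (the descent's objects), by `PrintChiDescent.sandwich_histGood_of_sandwich_succ` (p531138).

References: T. Bałaban, CMP 102 (1985) 255–275 [Balaban1985UV3] ((41) p.266, (47) p.267); C. King, CMP 102 (1986) 649–677 [King1986] (Thm 3.4 (3.9) p.656).
-/

noncomputable section

namespace Summit.QuantumFields.YangMills.Theorems.PrintChi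

open MeasureTheory Filter
open Literature.MathematicalPhysics.QuantumFieldTheory.Balaban1983to89
open Literature.MathematicalPhysics.QuantumFieldTheory.Balaban1983to89.T3ContinuumYM3Torus
open Literature.MathematicalPhysics.QuantumFieldTheory.Balaban1983to89.T3UnitLawDensityEML (ℰp measurableE_ℰp)
open Literature.MathematicalPhysics.QuantumFieldTheory.Balaban1983to89.T3UnitScaleTilt
open Literature.MathematicalPhysics.QuantumFieldTheory.Balaban1983to89.T3TiltDescent
open Literature.MathematicalPhysics.QuantumFieldTheory.Balaban1983to89.T3PrintedRegularMinimiser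
open Summit.QuantumFields.YangMills.Theorems.PrintChiDescent

section Feed

variable (F : T3Family) {γ b₀ p₀ ε₀ : ℝ}

/-- `|log y − log x − κ| ≤ r` with `x, y > 0` gives the two-sided bound `e^{κ−r}x ≤ y ≤ e^{κ+r}x`. [folklore] -/
theorem exp_sandwich_of_abs_log {x y κ r : ℝ} (hx : 0 < x) (hy : 0 < y) (h : |Real.log y - Real.log x - κ| ≤ r) :
    Real.exp (κ - r) * x ≤ y ∧ y ≤ Real.exp (κ + r) * x := by
  obtain ⟨hl, hu⟩ := abs_le.mp h
  have e : y = Real.exp (Real.log y - Real.log x) * x := by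
    rw [Real.exp_sub, Real.exp_log hy, Real.exp_log hx, div_mul_cancel₀ _ hx.ne']
  constructor
  · rw [e]
    exact mul_le_mul_of_nonneg_right (Real.exp_le_exp.mpr (by linarith)) hx.le
  · rw [e]
    exact mul_le_mul_of_nonneg_right (Real.exp_le_exp.mpr (by linarith)) hx.le

/-- **THE LEVEL-`(n+1)` SANDWICH OF THE `histGood·(n+1)`-RESTRICTED DENSITIES FROM THE SOCKETS.**  Runs `K`, `K+1` read at height `n+1 ≤ K` with interaction data
`Pint, E, Rm` (run `K`) and `Pint′, E′, Rm′` (run `K+1`) satisfying the χ-restricted representation `TwoSidedRepOn S` ([Balaban1985UV3] (41) ∧ (47) on `S`); a measurable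
good set `G` inside the window of height `n+1`, inside `S_K ∩ S_{K+1}` and inside the doubly-positive data; a.e. on `G` the two-run Cauchy bound of the interaction data
(`|Pint′ − Pint − c| ≤ r′`, [King1986] (3.9) on `G`) and the minimiser-stability bound at height `n+1` (`|β_{K+1}minActionRegPr_{n+1,K+1} − β_K minActionRegPr_{n+1,K} − κ₂| ≤ r₂`,
crux `MinimiserStabilityRegPr`'s currency).  Then a.e. on `G`: `e^{κ−r}ρ̃a ≤ ρ̃b ≤ e^{κ+r}ρ̃a`, `κ = c − E′ + E − κ₂`, `r = Rm + Rm′ + r′ + r₂`. [cite: King1986, Thm 3.4 (3.9) p.656] -/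
theorem sandwich_succ_of_repOn (hγ : 0 ≤ γ) {n K : ℕ} (h : n + 1 ≤ K)
    {S : (K n : ℕ) → n ≤ K → GaugeField (F.P n) 0 (Matrix.specialUnitaryGroup (Fin 2) ℂ) → Prop}
    {Pint Pint' : (K n : ℕ) → GaugeField (F.P n) 0 (Matrix.specialUnitaryGroup (Fin 2) ℂ) → ℝ} {E Rm E' Rm' : ℕ → ℕ → ℝ}
    (hrep : TwoSidedRepOn F γ b₀ p₀ S ε₀ Pint E Rm) (hrep' : TwoSidedRepOn F γ b₀ p₀ S ε₀ Pint' E' Rm')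
    {G : Set (GaugeField (F.P (n + 1)) 0 (Matrix.specialUnitaryGroup (Fin 2) ℂ))}
    (hGsub : G ⊆ {W | PlaqSmall (θBal F.L γ b₀ p₀ (n + 1)) W ∧ S K (n + 1) h W ∧ S (K + 1) (n + 1) (h.trans (Nat.le_succ K)) W ∧
      0 < heightDensity F γ h (histGood F ℰp (θBal F.L γ b₀ p₀) K (n + 1)) W ∧
      0 < heightDensity F γ (h.trans (Nat.le_succ K)) (histGood F ℰp (θBal F.L γ b₀ p₀) (K + 1) (n + 1)) W})
    {c r' κ₂ r₂ : ℝ}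
    (hcau : ∀ᵐ W ∂fieldMeasure (F.P (n + 1)) 0 (Matrix.specialUnitaryGroup (Fin 2) ℂ), W ∈ G →
      |Pint' (K + 1) (n + 1) W - Pint K (n + 1) W - c| ≤ r')
    (hms : ∀ᵐ W ∂fieldMeasure (F.P (n + 1)) 0 (Matrix.specialUnitaryGroup (Fin 2) ℂ), W ∈ G →
      |(F.scheme ℰp γ).β (K + 1) * minActionRegPr F (n + 1) (K + 1) (h.trans (Nat.le_succ K)) ε₀ W -
          (F.scheme ℰp γ).β K * minActionRegPr F (n + 1) K h ε₀ W - κ₂| ≤ r₂) :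
    ∀ᵐ W ∂fieldMeasure (F.P (n + 1)) 0 (Matrix.specialUnitaryGroup (Fin 2) ℂ), W ∈ G →
      Real.exp ((c - E' (K + 1) (n + 1) + E K (n + 1) - κ₂) - (Rm K (n + 1) + Rm' (K + 1) (n + 1) + r' + r₂)) *
            heightDensity F γ h (histGood F ℰp (θBal F.L γ b₀ p₀) K (n + 1)) W ≤
          heightDensity F γ (h.trans (Nat.le_succ K)) (histGood F ℰp (θBal F.L γ b₀ p₀) (K + 1) (n + 1)) W ∧
        heightDensity F γ (h.trans (Nat.le_succ K)) (histGood F ℰp (θBal F.L γ b₀ p₀) (K + 1) (n + 1)) W ≤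
          Real.exp ((c - E' (K + 1) (n + 1) + E K (n + 1) - κ₂) + (Rm K (n + 1) + Rm' (K + 1) (n + 1) + r' + r₂)) *
            heightDensity F γ h (histGood F ℰp (θBal F.L γ b₀ p₀) K (n + 1)) W := by
  have _ := hγ
  obtain ⟨-, -, hR⟩ := hrep
  obtain ⟨-, -, hR'⟩ := hrep'
  filter_upwards [hR K (n + 1) h, hR' (K + 1) (n + 1) (h.trans (Nat.le_succ K)), hcau, hms] with W hW hW' hc hm hWG
  obtain ⟨hs, hS, hS', h0, h0'⟩ := hGsub hWG
  have hy := hW hs hS h0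
  have hx := hW' hs hS' h0'
  have hPc := hc hWG
  have hmn := hm hWG
  refine exp_sandwich_of_abs_log h0 h0' ?_
  have key : ∀ la lb ma mb P P' e e' cc k2 : ℝ,
      lb - la - (cc - e' + e - k2) = (lb + mb - P' + e') - (la + ma - P + e) + (P' - P - cc) - (mb - ma - k2) := by
    intros
    ring
  rw [key _ _ ((F.scheme ℰp γ).β K * minActionRegPr F (n + 1) K h ε₀ W)
    ((F.scheme ℰp γ).β (K + 1) * minActionRegPr F (n + 1) (K + 1) (h.trans (Nat.le_succ K)) ε₀ W)
    (Pint K (n + 1) W) (Pint' (K + 1) (n + 1) W) (E K (n + 1)) (E' (K + 1) (n + 1)) c κ₂]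
  have h1 : |(Real.log (heightDensity F γ (h.trans (Nat.le_succ K)) (histGood F ℰp (θBal F.L γ b₀ p₀) (K + 1) (n + 1)) W) +
        (F.scheme ℰp γ).β (K + 1) * minActionRegPr F (n + 1) (K + 1) (h.trans (Nat.le_succ K)) ε₀ W - Pint' (K + 1) (n + 1) W + E' (K + 1) (n + 1)) -
      (Real.log (heightDensity F γ h (histGood F ℰp (θBal F.L γ b₀ p₀) K (n + 1)) W) +
        (F.scheme ℰp γ).β K * minActionRegPr F (n + 1) K h ε₀ W - Pint K (n + 1) W + E K (n + 1))| ≤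
      Rm' (K + 1) (n + 1) + Rm K (n + 1) := (abs_sub _ _).trans (add_le_add hx hy)
  calc _ ≤ |(Real.log (heightDensity F γ (h.trans (Nat.le_succ K)) (histGood F ℰp (θBal F.L γ b₀ p₀) (K + 1) (n + 1)) W) +
          (F.scheme ℰp γ).β (K + 1) * minActionRegPr F (n + 1) (K + 1) (h.trans (Nat.le_succ K)) ε₀ W - Pint' (K + 1) (n + 1) W + E' (K + 1) (n + 1)) -
        (Real.log (heightDensity F γ h (histGood F ℰp (θBal F.L γ b₀ p₀) K (n + 1)) W) +
          (F.scheme ℰp γ).β K * minActionRegPr F (n + 1) K h ε₀ W - Pint K (n + 1) W + E K (n + 1)) +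
        (Pint' (K + 1) (n + 1) W - Pint K (n + 1) W - c)| +
        |(F.scheme ℰp γ).β (K + 1) * minActionRegPr F (n + 1) (K + 1) (h.trans (Nat.le_succ K)) ε₀ W -
          (F.scheme ℰp γ).β K * minActionRegPr F (n + 1) K h ε₀ W - κ₂| := abs_sub _ _
    _ ≤ (Rm' (K + 1) (n + 1) + Rm K (n + 1) + r') + r₂ :=
        add_le_add ((abs_add_le _ _).trans (add_le_add h1 hPc)) hmn
    _ = Rm K (n + 1) + Rm' (K + 1) (n + 1) + r' + r₂ := by ring

/-- **THE SAME FOR THE DESCENT'S OBJECTS** (`histGood · n`-restricted densities at height `n+1`, `n = ` the comparison height): the indicator of the top window is common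
to both runs (`PrintChiDescent.sandwich_histGood_of_sandwich_succ`), so the conclusion of `sandwich_succ_of_repOn` IS the hypothesis `hcmp` of
`PrintChiDescent.fourPrime_pair_of_descent` with `κ = c − E′ + E − κ₂`, `r = Rm + Rm′ + r′ + r₂`. [cite: King1986, Thm 3.4 (3.9) p.656] -/
theorem sandwich_of_repOn (hγ : 0 ≤ γ) {n K : ℕ} (h : n + 1 ≤ K)
    {S : (K n : ℕ) → n ≤ K → GaugeField (F.P n) 0 (Matrix.specialUnitaryGroup (Fin 2) ℂ) → Prop}
    {Pint Pint' : (K n : ℕ) → GaugeField (F.P n) 0 (Matrix.specialUnitaryGroup (Fin 2) ℂ) → ℝ} {E Rm E' Rm' : ℕ → ℕ → ℝ}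
    (hrep : TwoSidedRepOn F γ b₀ p₀ S ε₀ Pint E Rm) (hrep' : TwoSidedRepOn F γ b₀ p₀ S ε₀ Pint' E' Rm')
    {G : Set (GaugeField (F.P (n + 1)) 0 (Matrix.specialUnitaryGroup (Fin 2) ℂ))}
    (hGsub : G ⊆ {W | PlaqSmall (θBal F.L γ b₀ p₀ (n + 1)) W ∧ S K (n + 1) h W ∧ S (K + 1) (n + 1) (h.trans (Nat.le_succ K)) W ∧
      0 < heightDensity F γ h (histGood F ℰp (θBal F.L γ b₀ p₀) K (n + 1)) W ∧
      0 < heightDensity F γ (h.trans (Nat.le_succ K)) (histGood F ℰp (θBal F.L γ b₀ p₀) (K + 1) (n + 1)) W})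
    {c r' κ₂ r₂ : ℝ}
    (hcau : ∀ᵐ W ∂fieldMeasure (F.P (n + 1)) 0 (Matrix.specialUnitaryGroup (Fin 2) ℂ), W ∈ G →
      |Pint' (K + 1) (n + 1) W - Pint K (n + 1) W - c| ≤ r')
    (hms : ∀ᵐ W ∂fieldMeasure (F.P (n + 1)) 0 (Matrix.specialUnitaryGroup (Fin 2) ℂ), W ∈ G →
      |(F.scheme ℰp γ).β (K + 1) * minActionRegPr F (n + 1) (K + 1) (h.trans (Nat.le_succ K)) ε₀ W -
          (F.scheme ℰp γ).β K * minActionRegPr F (n + 1) K h ε₀ W - κ₂| ≤ r₂) :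
    ∀ᵐ W ∂fieldMeasure (F.P (n + 1)) 0 (Matrix.specialUnitaryGroup (Fin 2) ℂ), W ∈ G →
      Real.exp ((c - E' (K + 1) (n + 1) + E K (n + 1) - κ₂) - (Rm K (n + 1) + Rm' (K + 1) (n + 1) + r' + r₂)) *
            heightDensity F γ h (histGood F ℰp (θBal F.L γ b₀ p₀) K n) W ≤
          heightDensity F γ (h.trans (Nat.le_succ K)) (histGood F ℰp (θBal F.L γ b₀ p₀) (K + 1) n) W ∧
        heightDensity F γ (h.trans (Nat.le_succ K)) (histGood F ℰp (θBal F.L γ b₀ p₀) (K + 1) n) W ≤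
          Real.exp ((c - E' (K + 1) (n + 1) + E K (n + 1) - κ₂) + (Rm K (n + 1) + Rm' (K + 1) (n + 1) + r' + r₂)) *
            heightDensity F γ h (histGood F ℰp (θBal F.L γ b₀ p₀) K n) W :=
  sandwich_histGood_of_sandwich_succ F hγ h (θBal F.L γ b₀ p₀) (sandwich_succ_of_repOn F hγ h hrep hrep' hGsub hcau hms)

end Feed

end Summit.QuantumFields.YangMills.Theorems.PrintChi

end
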